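import Literature.Computability.Complexity.MurrayWilliams2018EasyWitnessSanity
import HarnessLib

/-!
# Murray–Williams 2018, Lemma 4.1: the trivial regime of the conclusion, and growth of the
# stretched size functions

Companion of `MurrayWilliams2018EasyWitness.lean` (the Easy Witness Lemma for low nondeterministic
time, Murray–Williams 2018, Lemma 4.1, as the named fact `MurrayWilliams2018_lemma_4_1_ae`; the
notions `HasWitnessCircuits`, `NTIMEHasWitnessCircuits`, `stretch`). This file PROVES two groups of
elementary facts used to locate the content of the lemma and in the bookkeeping of its printed
proof (ECCC TR17-188, pp. 13–14):

* **The trivial regime.** Every string `y` is a prefix of the truth table of a `B₂`-circuit with at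
  most `10 · |y| + 1` gates (table lookup on `⌈log₂ |y|⌉` variables, `exists_circuit_truthTable_prefix`
  with the solved Shannon bound `univBound m ≤ 5 · 2ᵐ`; Arora–Barak 2009, Claim 2.13), so a witness of a `t`-time verifier
  with constant `c` — a string of length `≤ c · t(n) + c` — always has an encoding circuit of size
  `O(c · t(n))`: **`NTIMEHasWitnessCircuits_of_forall_eventually_le`** — if for every `c`,
  `c · t(n) + c ≤ w(n)` for all large `n`, then `NTIME t` has witness circuits of size `w`, with no
  hypothesis at all (sharpening the exponential calibration `NTIMEHasWitnessCircuits_univBound` of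
  `MurrayWilliams2018EasyWitnessSanity.lean`), and its `IsLittleO` form
  `NTIMEHasWitnessCircuits_of_isLittleO`. Consequently the conclusion of Lemma 4.1 — witness
  circuits of size `w(n) = s₂(s₂(s₂(n)))^{2g}` for `NTIME[t]` — holds outright whenever
  `t = o(w)` (`MurrayWilliams2018_lemma_4_1_conclusion_of_isLittleO`): the whole content of the
  lemma is in the regime where `t(n)` exceeds every fixed power of `s₂(s₂(s₂(n)))` — hypothesis (b),
  `t(n) ≥ s₂(s₂(s₂(n)))ᵈ`, bounds `t` only from below — which is where the printed proof needs a
  pseudorandom generator with seed length `O(log t(n))` at the hardness level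
  `s₂(s₂(s₂(n)))^{2g}` (Umans' generator, Thm. 2.1 of the source), see the review section of
  `MurrayWilliams2018EasyWitness.lean`.
* **Growth of the stretched functions** `s₂ = stretch s e : n ↦ s(e·n)ᵉ` for a strictly
  increasing `s` and `e ≥ 1`: `stretch s e` is strictly increasing, dominates `n`, `s n` and
  `(s n)ᵉ`, and so do its iterates; and proviso (a) of the lemma, `n · s(n) < 2^{n/e}` for large
  `n`, makes `s' : n ↦ s(e·n)` a circuit-size function in the sense of §3 of the source,
  `2n · s(e·n) < 2ⁿ` for large `n` (p. 13: "`s'(n) = s(e·n) < 2^{e·n/e}/(e·n) < 2ⁿ/(2n)` for all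
  sufficiently large `n` and `e ≥ 2`"), `eventually_two_mul_mul_stretchBase_lt`.

Theorems only; no definition, no machine, no named fact is introduced.

## References

* C. D. Murray, R. R. Williams, *Circuit lower bounds for nondeterministic quasi-polytime: an easy
  witness lemma for NP and NQP*, STOC 2018 (ECCC TR17-188), §2 (witness circuits, circuit
  complexity of strings), Lemma 4.1 and its proof, first bullet of p. 13 [MurrayWilliams2018].
* S. Arora, B. Barak, *Computational Complexity: A Modern Approach*, CUP 2009, Claim 2.13 (every
  function on `m` variables has a circuit of size `O(2ᵐ)`) [AroraBarak2009].
-/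

namespace Literature.Computability.Complexity

open Filter Asymptotics

/-! ### Every string has a linear-size encoding circuit -/

/-- **Every string has a linear-size encoding circuit**: `y` is a prefix of the truth table of a
`B₂`-circuit on `⌈log₂ |y|⌉` inputs with at most `10 · |y| + 1` gates (table lookup,
`exists_circuit_truthTable_prefix`, on the least number of variables: `2^{⌈log₂ |y|⌉} < 2 |y|` for
`|y| ≥ 1`). In the terminology of Murray–Williams, §2: `CC(y) = O(|y|)` for every string `y`.
[cite: AroraBarak2009, Claim 2.13] -/
theorem exists_circuit_truthTable_prefix_linear (y : List Bool) :
    ∃ (m : ℕ) (W : Circuit (Fin m)), W.IsOver B2 ∧ W.size ≤ 10 * y.length + 1 ∧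
      y <+: MetaComplexity.truthTable W.eval := by
  obtain ⟨W, hB, hs, hpre⟩ :=
    exists_circuit_truthTable_prefix y (Nat.clog 2 y.length) (Nat.le_pow_clog one_lt_two _)
  refine ⟨_, W, hB, hs.trans ?_, hpre⟩
  -- the Shannon-expansion bound solved: `univBound m + 4 ≤ 5 · 2ᵐ` (as in `NWQuickPRG.lean`,
  -- `MCSPProofs.lean`, which are not imported here)
  have h5 : ∀ m : ℕ, univBound m + 4 ≤ 5 * 2 ^ m := by
    intro m
    induction m with
    | zero => simp [univBound]
    | succ m ih => simp only [univBound, pow_succ]; omega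
  have h5 := h5 (Nat.clog 2 y.length)
  rcases Nat.lt_or_ge y.length 2 with hlt | hge
  · -- `|y| ≤ 1`: no variables, one gate
    have h0 : Nat.clog 2 y.length = 0 := by
      interval_cases h : y.length <;> simp
    rw [h0] at h5 ⊢
    simp only [pow_zero, mul_one] at h5
    omega
  · -- `|y| ≥ 2`: `2^{⌈log₂ |y|⌉ - 1} < |y|`
    have hlt : 2 ^ (Nat.clog 2 y.length - 1) < y.length :=
      Nat.pow_pred_clog_lt_self one_lt_two (by omega)
    have hpos : 1 ≤ Nat.clog 2 y.length := Nat.clog_pos one_lt_two hge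
    have h2 : 2 ^ Nat.clog 2 y.length = 2 * 2 ^ (Nat.clog 2 y.length - 1) := by
      rw [← pow_succ']
      congr 1
      omega
    omega

/-! ### The trivial regime: `t = o(w)` gives witness circuits of size `w` for free -/

/-- **Witness circuits in the trivial regime.** If for every constant `c` eventually
`c · t(n) + c ≤ w(n)`, then `NTIME t` has witness circuits of size `w` — unconditionally: for a
verifier `V` with constant `c`, every `x ∈ L` of large length has SOME accepted witness `y` with
`|y| ≤ c · t(|x|) + c`, and `y` is a prefix of the truth table of a circuit with
`≤ 10 |y| + 1 ≤ (10c + 1) · t(|x|) + (10c + 1)` gates (`exists_circuit_truthTable_prefix_linear`).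
Hence the content of the Easy Witness Lemma (`MurrayWilliams2018_lemma_4_1_ae`) lies entirely in
the regime where `t` is not `o(w)`, `w(n) = s₂(s₂(s₂(n)))^{2g}`. [cite: MurrayWilliams2018, §2 (Witness Circuits)] -/
theorem NTIMEHasWitnessCircuits_of_forall_eventually_le {t w : ℕ → ℕ}
    (h : ∀ c : ℕ, ∀ᶠ n in atTop, c * t n + c ≤ w n) : NTIMEHasWitnessCircuits t w := by
  intro L _ V
  obtain ⟨n₀, hn₀⟩ := eventually_atTop.1 (h (10 * V.c + 1))
  refine ⟨n₀, fun x hx hle => ?_⟩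
  obtain ⟨y, hy, hrel⟩ := (V.mem_iff x).1 hx
  obtain ⟨m, W, hB, hs, hpre⟩ := exists_circuit_truthTable_prefix_linear y
  refine ⟨m, W, y, hB, hs.trans ?_, hy, hrel, hpre⟩
  have h1 := hn₀ x.length hle
  have h2 : 10 * y.length + 1 ≤ 10 * (V.c * t x.length + V.c) + 1 := by omega
  refine h2.trans (le_trans ?_ h1)
  ring_nf
  omega

/-- **Witness circuits in the trivial regime, `IsLittleO` form**: if `t = o(w)` along `atTop`
(real casts) and `w → ∞`, then `NTIME t` has witness circuits of size `w`.
[cite: MurrayWilliams2018, §2 (Witness Circuits)] -/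
theorem NTIMEHasWitnessCircuits_of_isLittleO {t w : ℕ → ℕ}
    (h : (fun n => (t n : ℝ)) =o[atTop] (fun n => (w n : ℝ)))
    (hw : Tendsto w atTop atTop) : NTIMEHasWitnessCircuits t w := by
  refine NTIMEHasWitnessCircuits_of_forall_eventually_le fun c => ?_
  -- `c · t n ≤ w n / 2` eventually (little-o with constant `1/(2c+2)`), and `c ≤ w n / 2` eventually
  have h1 : ∀ᶠ n in atTop, ((2 * c : ℕ) : ℝ) * (t n : ℝ) ≤ (w n : ℝ) := by
    rcases Nat.eq_zero_or_pos c with rfl | hc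
    · exact Eventually.of_forall fun n => by simp
    · have hpos : (0 : ℝ) < 1 / (2 * c) := by positivity
      filter_upwards [h.def hpos] with n hn
      rw [Real.norm_natCast, Real.norm_natCast] at hn
      have hc' : (0 : ℝ) < 2 * c := by positivity
      calc ((2 * c : ℕ) : ℝ) * (t n : ℝ) = (2 * c : ℝ) * (t n : ℝ) := by push_cast; ring
        _ ≤ (2 * c : ℝ) * (1 / (2 * c) * (w n : ℝ)) := by gcongr
        _ = (w n : ℝ) := by field_simp
  have h2 : ∀ᶠ n in atTop, 2 * c ≤ w n := (tendsto_atTop.1 hw) (2 * c)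
  filter_upwards [h1, h2] with n hn1 hn2
  have h3 : 2 * (c * t n) ≤ w n := by
    have h4 : (((2 * (c * t n) : ℕ)) : ℝ) ≤ (w n : ℝ) := by
      have h5 : (((2 * c : ℕ)) : ℝ) * (t n : ℝ) = (((2 * (c * t n) : ℕ)) : ℝ) := by
        push_cast; ring
      rw [← h5]; exact hn1
    exact_mod_cast h4
  omega

/-- **The conclusion of Lemma 4.1 in the trivial regime.** For ANY `s`, `e`, `g` and `t` with
`t = o(s₂(s₂(s₂(·)))^{2g})`, `s₂ = stretch s e`, and `s₂(s₂(s₂(n)))^{2g} → ∞`, `NTIME t` has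
witness circuits of size `s₂(s₂(s₂(n)))^{2g}` — none of the hypotheses (a), (b) or the circuit
upper bound for `NTIME[tᵉ]` of `MurrayWilliams2018_lemma_4_1_ae` is needed there. (Calibration of
the named fact: its hypothesis (b), `t(n) ≥ s₂(s₂(s₂(n)))ᵈ`, bounds `t` from below only, and the
lemma's content is the complementary regime.) [cite: MurrayWilliams2018, Lemma 4.1] -/
theorem MurrayWilliams2018_lemma_4_1_conclusion_of_isLittleO {s t : ℕ → ℕ} {e g : ℕ}
    (h : (fun n => (t n : ℝ)) =o[atTop] (fun n => ((((stretch s e)^[3] n) ^ (2 * g) : ℕ) : ℝ)))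
    (hw : Tendsto (fun n => ((stretch s e)^[3] n) ^ (2 * g)) atTop atTop) :
    NTIMEHasWitnessCircuits t (fun n => ((stretch s e)^[3] n) ^ (2 * g)) :=
  NTIMEHasWitnessCircuits_of_isLittleO h hw

/-! ### Growth of the stretched size functions -/

section Stretch

variable {s : ℕ → ℕ} {e : ℕ}

/-- `stretch s e` is monotone for monotone `s`. [folklore] -/
theorem stretch_monotone (hs : Monotone s) (e : ℕ) : Monotone (stretch s e) := fun a b hab => by
  simp only [stretch_apply]
  exact Nat.pow_le_pow_left (hs (Nat.mul_le_mul_left e hab)) e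

/-- `stretch s e` is strictly increasing for strictly increasing `s` and `e ≥ 1`. [folklore] -/
theorem stretch_strictMono (hs : StrictMono s) (he : 1 ≤ e) : StrictMono (stretch s e) :=
  fun a b hab => by
    simp only [stretch_apply]
    exact Nat.pow_lt_pow_left (hs (Nat.mul_lt_mul_of_pos_left hab (by omega))) (by omega)

/-- `(s n)ᵉ ≤ stretch s e n` for monotone `s` and `e ≥ 1`. [folklore] -/
theorem pow_le_stretch (hs : Monotone s) (he : 1 ≤ e) (n : ℕ) : s n ^ e ≤ stretch s e n := by
  rw [stretch_apply]
  exact Nat.pow_le_pow_left (hs (Nat.le_mul_of_pos_left n (by omega))) e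

/-- `s n ≤ stretch s e n` for monotone `s` and `e ≥ 1`. [folklore] -/
theorem le_stretch (hs : Monotone s) (he : 1 ≤ e) (n : ℕ) : s n ≤ stretch s e n := by
  rcases Nat.eq_zero_or_pos (s n) with h0 | hpos
  · rw [h0]; exact Nat.zero_le _
  · exact (Nat.le_self_pow (by omega) _).trans (pow_le_stretch hs he n)

/-- `n ≤ stretch s e n` for strictly increasing `s` and `e ≥ 1`. [folklore] -/
theorem id_le_stretch (hs : StrictMono s) (he : 1 ≤ e) (n : ℕ) : n ≤ stretch s e n :=
  (hs.id_le n).trans (le_stretch hs.monotone he n)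

/-- The iterates of `stretch s e` dominate the identity. [folklore] -/
theorem id_le_stretch_iterate (hs : StrictMono s) (he : 1 ≤ e) (k n : ℕ) :
    n ≤ (stretch s e)^[k] n := by
  induction k with
  | zero => simp
  | succ k ih => exact ih.trans (by
      rw [Function.iterate_succ_apply']
      exact id_le_stretch hs he _)

/-- The iterates of `stretch s e` are monotone in the number of iterations. [folklore] -/
theorem stretch_iterate_le_iterate_succ (hs : StrictMono s) (he : 1 ≤ e) (k n : ℕ) :
    (stretch s e)^[k] n ≤ (stretch s e)^[k + 1] n := by
  rw [Function.iterate_succ_apply']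
  exact id_le_stretch hs he _

/-- The iterates of `stretch s e` are strictly increasing functions. [folklore] -/
theorem stretch_iterate_strictMono (hs : StrictMono s) (he : 1 ≤ e) (k : ℕ) :
    StrictMono ((stretch s e)^[k]) := by
  induction k with
  | zero => simpa using strictMono_id
  | succ k ih =>
    intro a b hab
    simp only [Function.iterate_succ_apply']
    exact stretch_strictMono hs he (ih hab)

/-- `s n ≤ s₂(s₂(s₂(n)))` and more generally `s n ≤ (stretch s e)^[k+1] n`. [folklore] -/
theorem le_stretch_iterate_succ (hs : StrictMono s) (he : 1 ≤ e) (k n : ℕ) :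
    s n ≤ (stretch s e)^[k + 1] n := by
  rw [Function.iterate_succ_apply]
  have h1 : s n ≤ stretch s e n := le_stretch hs.monotone he n
  exact h1.trans (id_le_stretch_iterate hs he k _)

/-- **`s' = s(e ·)` is a circuit-size function under proviso (a).** If `n · s(n) < 2^{n/e}` for all
large `n` and `e ≥ 2`, then `2n · s(e·n) < 2ⁿ` for all large `n` (at `m = e·n`:
`e·n · s(e·n) < 2^{(e n)/e} = 2ⁿ` and `2n ≤ e·n`) — the first bullet on p. 13 of the source,
"`s'(n) = s(e·n) < 2^{e·n/e}/(e·n) < 2ⁿ/(2n)`". [cite: MurrayWilliams2018, Lemma 4.1 (proof)] -/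
theorem eventually_two_mul_mul_stretchBase_lt (he : 2 ≤ e)
    (ha : ∀ᶠ n in atTop, n * s n < 2 ^ (n / e)) :
    ∀ᶠ n in atTop, 2 * n * s (e * n) < 2 ^ n := by
  obtain ⟨N, hN⟩ := eventually_atTop.1 ha
  refine eventually_atTop.2 ⟨N, fun n hn => ?_⟩
  have h1 := hN (e * n) (hn.trans (Nat.le_mul_of_pos_left n (by omega)))
  rw [Nat.mul_div_cancel_left n (by omega)] at h1
  calc 2 * n * s (e * n) ≤ e * n * s (e * n) := Nat.mul_le_mul_right _ (Nat.mul_le_mul_right _ he)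
    _ < 2 ^ n := h1

/-- Under proviso (a), `s(n) < 2ⁿ` eventually (indeed `n · s(n) < 2^{n/e} ≤ 2ⁿ`). [folklore] -/
theorem eventually_lt_two_pow_of_proviso (ha : ∀ᶠ n in atTop, n * s n < 2 ^ (n / e)) :
    ∀ᶠ n in atTop, s n < 2 ^ n := by
  filter_upwards [ha, eventually_ge_atTop 1] with n hn h1
  calc s n ≤ n * s n := Nat.le_mul_of_pos_left _ h1
    _ < 2 ^ (n / e) := hn
    _ ≤ 2 ^ n := Nat.pow_le_pow_right two_pos (Nat.div_le_self n e)

end Stretch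

end Literature.Computability.Complexity
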